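import Literature.NumberTheory.LFunctions.AlternativeHypothesisFormFactorProofs
import Literature.NumberTheory.LFunctions.MontgomeryTheoremGoldstonMontgomery
import HarnessLib

/-!
# BGSTB 2025, Corollary 5 from Lemma 5 — proved (the RH-side chain of §5, modulo (MT))

LABEL (cell `rh-crit`, corpus C5 `ah`; joint t5/t6 file per rh-crit/ah R-g5-36): **NOT RH-BEARING.**
Conditional kernel deductions inside the preprint Baluyot–Goldston–Suriajaya–Turnage-Butterbaugh
2025
(arXiv:2508.10857, UNDER REVIEW): the antecedent RH is printed, AH-Pairs is a PREDICATE consumed as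
a
hypothesis; THEOREMS ONLY, no named fact. bears_on: LADDER-RH §4 HELD «conditional bridges:
exceptional zero ⇒ …». WHAT THIS IS NOT: a claim about RH or AH; nothing here bears on the truth of
RH.

Source (held `paper:arxiv-2508.10857`, chunks p0012–p0013): §5, Lemma 5 (Heath-Brown) (i)–(iv),
**Corollary 5**: "Assuming the Riemann Hypothesis and AH-Pairs, we have, for `0 < λ ≤ 1/4`,
`∫_{1−λ}^{1+λ} G_λ(α) dα = 2(P_0 − 1) + O(λ) + O(E_G(λ,1)) + O(1/(λ²√log T))`", and its proof
"(Cor5-G(1)ave)" via (Cor5-1)–(Cor5-4). Typed statements: `bgstb2025_lemma5_rh`,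
`bgstb2025_corollary5`
(`AlternativeHypothesisFormFactor.lean`, seat t5); the AH-Pairs half (iii)–(iv) of Lemma 5 in the
form §5 proves (under RH) is the tree theorem `bgstb2025_lemma5_ah_of_RH`
(`AlternativeHypothesisFormFactorProofs.lean`, seat t5; rh-crit/ah E-ah-2).

## What is proved

`bgstb2025_corollary5_of_lemma5_rh : bgstb2025_lemma5_rh → bgstb2025_corollary5` — Corollary 5
modulo
the RH half (i)–(ii) of Lemma 5 (itself a consequence of Montgomery's theorem with the
Goldston–Montgomery rate, (MT); its discharge `bgstb2025_lemma5_rh_holds` is the next item of this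
file's programme). The AH half enters through `bgstb2025_lemma5_ah_of_RH hRH`, legitimately: RH is
Corollary 5's own antecedent. The printed proof is followed step by step:
* (Cor5-1) `∫_0^2 G_λ = 2P_0 + O(E_G(λ, 1))`: integrate (iii) termwise — the `k`-series is a finite
sum
  (`AH.tsum_mul_binDensity_eq_sum`), `∫_0^2 e^{iπkα} dα = 2·1_{k=0}`
(`AH.integral_cexp_pi_mul_int`),
  and `E_G(λ, α) ≤ (|α| + 1)E_G(λ, 1)` (`AH.errG_le_mul_errG_one`); `G_λ(·, T)` is continuous
  (`AH.continuous_heathBrownG`, a parametric interval integral of the tree's continuous `F`), hence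
  interval-integrable everywhere;
* (Cor5-2) `∫_0^2 = ∫_{−λ}^{λ} + 2∫_λ^{1−λ} + ∫_{1−λ}^{1+λ} + O(E_G(λ,1))`: the pieces `[1+λ, 2−λ]`
and
  `[2−λ, 2]` are moved by `α ↦ α − 2` with (iv) (`L = 1`, cost `≤ 4|C|E_G(λ,1)` pointwise) and
folded by
  evenness (`AH.heathBrownG_neg`);
* (Cor5-3) `∫_{−λ}^{λ} G_λ = 1 + O(λ² + 1/√log T + 1/(λ log T))` from (i) (at the endpoint `α = λ`,
where
  (i) is not stated, (ii) gives the same bound with constant `C + 1`), `∫_{−λ}^{λ}(λ − |α|)/λ² dα =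
1`
  (`AH.integral_triangle_div_sq`);
* (Cor5-4) `∫_λ^{1−λ} G_λ = ½ − λ + O(1/√log T + 1/(λ² log T))` from (ii);
* "for simplicity slightly degrading the error terms": every error is `≤ λ + E_G(λ,1) + 1/(λ²√log
T)`
  up to constants once `log T ≥ 1` (`T ≥ 3`); the constant is `14|C_AH| + 8|C_RH| + 6`.

## v2 (appended): Lemma 5 (i)–(ii) from (MT), and the discharges

`bgstb2025_lemma5_rh_of_MT` — the RH half (i)–(ii) of Lemma 5 (with `G_λ ≥ 0`) from Montgomery's
theorem (MT) with the Goldston–Montgomery rate on the CLOSED range `0 ≤ α ≤ 1` and `F ≥ 0`, taken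
as hypotheses in the exact shape of the tree theorems
`Montgomery.montgomery_pair_correlation_sqrtLog_Icc` / `Montgomery.montgomeryFormFactor_nonneg`
(`MontgomeryTheoremGoldstonMontgomery.lean`, seat t1; rh-crit/ah SIG-F3 (1), (3)); hence
`bgstb2025_lemma5_rh_holds : bgstb2025_lemma5_rh` and `bgstb2025_corollary5_holds :
bgstb2025_corollary5` (both named facts of `AlternativeHypothesisFormFactor.lean` DISCHARGED; RH
remains the printed antecedent inside each statement). The printed proof of (i)–(ii) (§5,
(lem4proof)) is followed: (MT) is inserted under the triangle `λ − |β|` (valid since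
`|α + β| ≤ 2λ ≤ 1`, resp. `0 ≤ α + β ≤ 1`), the main terms are the kernel integral
`λ⁻²∫(λ−|β|)T^{−2|α+β|} log T dβ` and `λ⁻²∫(λ−|β|)|α+β| dβ` (`= α` exactly in range (ii), `≤ 4λ`
in range (i)), evenness reduces to `α ≥ 0`. Deviations (ours, shorter in Lean): instead of the
closed form `(λ−α)/λ² + (T^{−2(λ−α)} − 2T^{−2α} + T^{−2(λ+α)})/(4λ² log² T)·log T` we bound the
kernel integral against `(λ − α)·(mass of L e^{−2L|u|} on [α−λ, α+λ])` with the `|α|−|β|`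
correction `≤ 2/log T` and boundary terms `≤ 1/(2 log T)`; in range (ii) `(λ−|β|) ≤ α+β` and
`uLe^{−2Lu} ≤ e^{−Lu}` give `≤ 1/log T` directly; the (MT) error is carried additively (not as a
factor `1 + O(1/√log T)`). Constant `C = 2|C₀| + 4` (`C₀` the (MT) constant), threshold `T ≥ 3`
intersected with (MT)'s.

## Correction of record (quotation hygiene; rh-crit/ah R-g5-39 (c), referee cell ask 12:05Z;
mathematics unaffected)

In `AlternativeHypothesisConsequences.lean`, Part H (the landed append p437165, this seat), the
sentence placed inside quotation marks as «If we substitute (AH1) into Theorem 2 and use (averageP)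
we immediately obtain …» is NOT verbatim. GLSS 2026, §2 (arXiv:2507.06823, p. 5) prints: "If we
substitute (SumtwoPs) into Theorem (thm2) and use (Sumk) we immediately obtain the following average
form of (thm1b)." — (SumtwoPs) being the display tagged (AH1) and (Sumk) the display
`Σ_{j=1}^{M} P_j(T) = M/2 + O(1/M) + O(MR_P(T))`. The labels «(AH1)» / «(averageP)» written there
are OUR harmonisation and route gloss, which belong outside the quotation marks: the formal proof
`glss2026_theorem3_of_theorem2` sums (AH1) over `j` (the display labelled (averageP_{k/2}) in the
source, "on adding these densities, we obtain") and does not pass through (Sumk), which the print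
derives using (SumHalfk) = (AH2).

## References

* [BaluyotGoldstonSuriajayaTurnageButterbaugh2025] §5: (G_λ), (E_G), Lemma 5, Corollary 5 and its
proof
  (Cor5-1)–(Cor5-4).
* [Montgomery1973] §1, Theorem (the form factor `F`, even and continuous in `α`; (MT) with the
  Goldston–Montgomery rate: tree `Montgomery.montgomery_pair_correlation_sqrtLog_Icc`, seat t1).
-/

noncomputable section

open Filter Real MeasureTheory intervalIntegral
open scoped Topology

namespace Literature.NumberTheory.LFunctions

namespace AH

/-! ### Helpers for Corollary 5 -/

/-- `G_λ(α, T)` is continuous in `α` (a parametric interval integral of the continuous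
`(α, β) ↦ (λ − |β|) F(α + β)`). [cite: BaluyotGoldstonSuriajayaTurnageButterbaugh2025, §5 (G_λ)] -/
theorem continuous_heathBrownG (lam T : ℝ) : Continuous fun α : ℝ ↦ heathBrownG lam α T := by
  unfold heathBrownG
  refine continuous_const.mul ?_
  have hF := RudnickSarnak.continuous_montgomeryFormFactor T
  have hunc : Continuous (Function.uncurry fun (α β : ℝ) ↦
      (lam - |β|) * montgomeryFormFactor (α + β) T) := by
    apply Continuous.mul
    · exact continuous_const.sub (continuous_abs.comp continuous_snd)
    · exact hF.comp (continuous_fst.add continuous_snd)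
  exact intervalIntegral.continuous_parametric_intervalIntegral_of_continuous' hunc (-lam) lam

/-- `∫_{−λ}^{λ} (λ − |α|)/λ² dα = 1` (`λ > 0`). [cite:
BaluyotGoldstonSuriajayaTurnageButterbaugh2025, §5 (Cor5-3)] -/
theorem integral_triangle_div_sq {lam : ℝ} (hlam : 0 < lam) :
    ∫ α in (-lam)..lam, (lam - |α|) / lam ^ 2 = 1 := by
  have hcont : Continuous fun α : ℝ ↦ (lam - |α|) / lam ^ 2 := by
    exact (continuous_const.sub continuous_abs).div_const _
  rw [← integral_add_adjacent_intervals (b := 0) (hcont.intervalIntegrable _ _)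
    (hcont.intervalIntegrable _ _)]
  have h1 : ∫ α in (-lam)..0, (lam - |α|) / lam ^ 2 = ∫ α in (-lam)..0, (lam + α) / lam ^ 2 := by
    refine integral_congr fun α hα ↦ ?_
    rw [Set.uIcc_of_le (by linarith)] at hα
    rw [abs_of_nonpos hα.2]
    ring
  have h2 : ∫ α in (0 : ℝ)..lam, (lam - |α|) / lam ^ 2 = ∫ α in (0 : ℝ)..lam, (lam - α) / lam ^ 2 := by
    refine integral_congr fun α hα ↦ ?_
    rw [Set.uIcc_of_le hlam.le] at hα
    rw [abs_of_nonneg hα.1]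
  rw [h1, h2]
  have e1 : (fun α : ℝ ↦ (lam + α) / lam ^ 2) = fun α ↦ 1 / lam ^ 2 * α + lam / lam ^ 2 := by
    funext α; ring
  have e2 : (fun α : ℝ ↦ (lam - α) / lam ^ 2) = fun α ↦ -(1 / lam ^ 2) * α + lam / lam ^ 2 := by
    funext α; ring
  have i1 : IntervalIntegrable (fun α : ℝ ↦ 1 / lam ^ 2 * α) volume (-lam) 0 :=
    (continuous_const.mul continuous_id).intervalIntegrable _ _
  have i2 : IntervalIntegrable (fun _ : ℝ ↦ lam / lam ^ 2) volume (-lam) 0 :=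
    continuous_const.intervalIntegrable _ _
  have i3 : IntervalIntegrable (fun α : ℝ ↦ -(1 / lam ^ 2) * α) volume 0 lam :=
    (continuous_const.mul continuous_id).intervalIntegrable _ _
  have i4 : IntervalIntegrable (fun _ : ℝ ↦ lam / lam ^ 2) volume 0 lam :=
    continuous_const.intervalIntegrable _ _
  rw [e1, e2, intervalIntegral.integral_add i1 i2, intervalIntegral.integral_add i3 i4,
    intervalIntegral.integral_const_mul, intervalIntegral.integral_const_mul, integral_id, integral_id,
    intervalIntegral.integral_const, intervalIntegral.integral_const]
  simp only [smul_eq_mul]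
  field_simp
  ring

/-- `∫_0^2 e^{iπkα} dα = 2·1_{k=0}` (`k ∈ ℤ`). [cite:
BaluyotGoldstonSuriajayaTurnageButterbaugh2025, §5 (proof of Corollary 5)] -/
theorem integral_cexp_pi_mul_int (k : ℤ) :
    ∫ α in (0 : ℝ)..2, Complex.exp (π * k * α * Complex.I) = if k = 0 then 2 else 0 := by
  split_ifs with hk
  · subst hk
    simp
  · have hc : (π * k * Complex.I : ℂ) ≠ 0 := by
      apply mul_ne_zero (mul_ne_zero _ _) Complex.I_ne_zero
      · exact_mod_cast Real.pi_ne_zero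
      · exact_mod_cast hk
    have e : (fun α : ℝ ↦ Complex.exp (π * k * α * Complex.I)) =
        fun α : ℝ ↦ Complex.exp ((π * k * Complex.I) * α) := by
      funext α; ring_nf
    rw [e, integral_exp_mul_complex hc]
    have h2 : Complex.exp (π * k * Complex.I * (2 : ℝ)) = 1 := by
      have : (π * k * Complex.I * (2 : ℝ) : ℂ) = k * (2 * π * Complex.I) := by push_cast; ring
      rw [this]
      exact Complex.exp_int_mul_two_pi_mul_I k
    rw [h2]
    simp

/-- Monotonicity of `E_G(λ, α)` in `|α|` and its scaling: `E_G(λ, α) ≤ (|α| + 1) E_G(λ, 1)/2 · …`;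
concretely `E_G(λ, α) ≤ ((|α| + 1)/2) · E_G(λ, 1)` fails for the constant terms, so we record the
crude `E_G(λ, α) ≤ (|α| + 1) E_G(λ, 1)` (all terms non-negative). [cite:
BaluyotGoldstonSuriajayaTurnageButterbaugh2025, §5 (E_G)] -/
theorem errG_le_mul_errG_one {M RT T lam α : ℝ} (hM : 0 ≤ M) (hRT : 0 ≤ RT) (hT : 1 < T) :
    errG M RT T lam α ≤ (|α| + 1) * errG M RT T lam 1 := by
  unfold errG
  have hlog : 0 < Real.log T := Real.log_pos hT
  have h1 : 0 ≤ 1 / (lam ^ 2 * M) := by positivity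
  have h2 : 0 ≤ 1 / Real.log T := by positivity
  have h3 : 0 ≤ M ^ 2 * RT := by positivity
  have ha : 0 ≤ |α| := abs_nonneg α
  simp only [abs_one]
  nlinarith

end AH

set_option maxHeartbeats 400000 in
open AH in
/-- **BGSTB 2025, Corollary 5 from Lemma 5** (the printed proof, §5 (Cor5-1)–(Cor5-4)). The RH half
(i)–(ii) of Lemma 5 is the hypothesis `bgstb2025_lemma5_rh`; the AH-Pairs half (iii)–(iv) is the
tree theorem `bgstb2025_lemma5_ah_of_RH` (the form §5 proves, under RH — which is Corollary 5's own
antecedent). (Cor5-1) `∫_0^2 G_λ = 2P_0 + O(E_G(λ,1))` by integrating (iii) termwise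
(`∫_0^2 e^{iπkα} dα = 2·1_{k=0}`); (Cor5-2) `[0, 2]` folds onto `∫_{−λ}^{λ} + 2∫_λ^{1−λ} +
∫_{1−λ}^{1+λ}`
by evenness (`AH.heathBrownG_neg`) and periodicity (iv); (Cor5-3) `∫_{−λ}^{λ} G_λ = 1 + O(λ² +
1/√log T + 1/(λ log T))` from (i); (Cor5-4) `∫_λ^{1−λ} G_λ = ½ − λ + O(1/√log T + 1/(λ² log T))`
from
(ii); the error terms are then degraded to `O(λ) + O(E_G(λ, 1)) + O(1/(λ²√log T))` as printed.
[cite: BaluyotGoldstonSuriajayaTurnageButterbaugh2025, Corollary 5 (proof §5)] -/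
theorem bgstb2025_corollary5_of_lemma5_rh (h5 : bgstb2025_lemma5_rh) : bgstb2025_corollary5 := by
  intro hRH M hM R hR δ hδ hδ2
  obtain ⟨-, C₁, h₁⟩ := h5 hRH
  obtain ⟨C₂, h₂⟩ := bgstb2025_lemma5_ah_of_RH hRH M hM R hR δ hδ hδ2
  have hR0 : ∀ T, 0 < R T := hR.1
  refine ⟨14 * |C₂| + 8 * |C₁| + 6, ?_⟩
  filter_upwards [h₁, h₂, eventually_ge_atTop (3 : ℝ)] with T hT₁ hT₂ hT3
  intro lam hlam hlam4
  have hT1 : (1 : ℝ) < T := by linarith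
  have hlam2 : lam ≤ 1 / 2 := by linarith
  have hlam1 : lam ≤ 1 := by linarith
  -- `log T ≥ 1`
  have hlog1 : 1 ≤ Real.log T := by
    rw [← Real.log_exp 1]
    exact Real.log_le_log (Real.exp_pos 1) (by have := Real.exp_one_lt_d9; linarith)
  have hlog0 : 0 < Real.log T := by linarith
  have hsq1 : 1 ≤ Real.sqrt (Real.log T) := by
    rw [show (1 : ℝ) = Real.sqrt 1 by simp]; exact Real.sqrt_le_sqrt hlog1
  have hsq0 : 0 < Real.sqrt (Real.log T) := by linarith
  have hsqle : Real.sqrt (Real.log T) ≤ Real.log T := by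
    have h := Real.sq_sqrt hlog0.le
    nlinarith
  -- notation
  set G : ℝ → ℝ := fun α ↦ AH.heathBrownG lam α T with hG
  set E1 : ℝ := AH.errG M (R T) T lam 1 with hE1
  set Q : ℝ := 1 / (lam ^ 2 * Real.sqrt (Real.log T)) with hQ
  set P0 : ℝ := AH.binDensity 0 T M δ with hP0
  have hE10 : 0 ≤ E1 := by
    rw [hE1]; unfold AH.errG
    have := hR0 T
    positivity
  have hQ0 : 0 ≤ Q := by positivity
  have hGc : Continuous G := AH.continuous_heathBrownG lam T
  have hGi : ∀ a b : ℝ, IntervalIntegrable G volume a b := fun a b ↦ hGc.intervalIntegrable a b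
  have hab1 := (hT₁ lam hlam hlam2)
  have hab2 := (hT₂ lam hlam hlam2)
  -- `E_G(λ, α) ≤ (|α| + 1) E_G(λ, 1)`
  have hEle : ∀ α : ℝ, AH.errG M (R T) T lam α ≤ (|α| + 1) * E1 := fun α ↦
    AH.errG_le_mul_errG_one hM.le (hR0 T).le hT1
  -- useful comparisons
  have hQ1 : 1 / Real.sqrt (Real.log T) ≤ Q := by
    rw [hQ]
    apply div_le_div_of_nonneg_left zero_le_one (by positivity)
    calc lam ^ 2 * Real.sqrt (Real.log T) ≤ 1 * Real.sqrt (Real.log T) := by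
          gcongr; nlinarith
      _ = Real.sqrt (Real.log T) := one_mul _
  have hQ2 : 1 / (lam ^ 2 * Real.log T) ≤ Q := by
    rw [hQ]
    apply div_le_div_of_nonneg_left zero_le_one (by positivity)
    exact mul_le_mul_of_nonneg_left hsqle (by positivity)
  have hQ3 : 1 / (lam * Real.log T) ≤ Q := by
    rw [hQ]
    apply div_le_div_of_nonneg_left zero_le_one (by positivity)
    -- `λ² √L ≤ λ L` since `λ ≤ 1 ≤ √L`
    have h1 : lam ^ 2 * Real.sqrt (Real.log T) = lam * (lam * Real.sqrt (Real.log T)) := by ring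
    rw [h1]
    refine mul_le_mul_of_nonneg_left ?_ hlam.le
    calc lam * Real.sqrt (Real.log T) ≤ 1 * Real.sqrt (Real.log T) := by gcongr
      _ ≤ Real.sqrt (Real.log T) * Real.sqrt (Real.log T) := by
          rw [one_mul]; exact le_mul_of_one_le_left hsq0.le hsq1
      _ = Real.log T := Real.mul_self_sqrt hlog0.le
  ---------------------------------------------------------------------------
  -- (Cor5-1): `|∫_0^2 G − 2P₀| ≤ 6|C₂| E1`
  ---------------------------------------------------------------------------
  have hN : 2 * M + 1 ≤ ((⌈2 * M + 1⌉₊ : ℕ) : ℝ) := Nat.le_ceil _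
  set N : ℕ := ⌈2 * M + 1⌉₊ with hNdef
  set b : ℤ → ℝ := fun k ↦ Real.sinc (lam * π * k / 2) ^ 2 * AH.binDensity k T M δ with hb
  set Sf : ℝ → ℂ := fun α ↦ ∑ k ∈ Finset.Icc (-(N : ℤ)) N,
    Complex.exp (π * k * α * Complex.I) * ((b k : ℝ) : ℂ) with hSf
  have hSf_eq : ∀ α : ℝ, ∑' k : ℤ, Complex.exp (π * k * α * Complex.I) *
      ((Real.sinc (lam * π * k / 2) ^ 2 * AH.binDensity k T M δ : ℝ) : ℂ) = Sf α := fun α ↦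
    AH.tsum_mul_binDensity_eq_sum (by linarith) hN _ _
  have hterm_c : ∀ k : ℤ, Continuous fun α : ℝ ↦
      Complex.exp (π * k * α * Complex.I) * ((b k : ℝ) : ℂ) := by
    intro k
    refine Continuous.mul ?_ continuous_const
    refine Complex.continuous_exp.comp ?_
    exact ((continuous_const.mul Complex.continuous_ofReal).mul continuous_const)
  have hSfc : Continuous Sf := by
    rw [hSf]
    exact continuous_finsetSum _ fun k _ ↦ hterm_c k
  have hSf_int : ∫ α in (0 : ℝ)..2, Sf α = 2 * (P0 : ℂ) := by
    have hint : ∀ k ∈ Finset.Icc (-(N : ℤ)) N, IntervalIntegrable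
        (fun α : ℝ ↦ Complex.exp (π * k * α * Complex.I) * ((b k : ℝ) : ℂ)) volume 0 2 :=
      fun k _ ↦ (hterm_c k).intervalIntegrable _ _
    rw [hSf]
    show (∫ α in (0 : ℝ)..2, ∑ k ∈ Finset.Icc (-(N : ℤ)) N,
      Complex.exp (π * k * α * Complex.I) * ((b k : ℝ) : ℂ)) = 2 * (P0 : ℂ)
    rw [intervalIntegral.integral_finsetSum hint]
    simp_rw [intervalIntegral.integral_mul_const, AH.integral_cexp_pi_mul_int, ite_mul, zero_mul]
    rw [Finset.sum_ite_eq']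
    have h0 : (0 : ℤ) ∈ Finset.Icc (-(N : ℤ)) N := by simp
    rw [if_pos h0, hb]
    simp [hP0]
  have hGC : IntervalIntegrable (fun α ↦ (G α : ℂ)) volume 0 2 :=
    (Complex.continuous_ofReal.comp hGc).intervalIntegrable _ _
  have hdiff : ‖(∫ α in (0 : ℝ)..2, ((G α : ℂ) - Sf α))‖ ≤ 3 * |C₂| * E1 * |(2 : ℝ) - 0| := by
    refine intervalIntegral.norm_integral_le_of_norm_le_const fun α hα ↦ ?_
    rw [Set.uIoc_of_le (by norm_num)] at hα
    have hαabs : |α| ≤ 2 := abs_le.mpr ⟨by linarith [hα.1], hα.2⟩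
    have h := (hab2 α).1
    rw [hSf_eq α] at h
    calc ‖(G α : ℂ) - Sf α‖ ≤ C₂ * AH.errG M (R T) T lam α := h
      _ ≤ |C₂| * AH.errG M (R T) T lam α := by
          refine mul_le_mul_of_nonneg_right (le_abs_self _) ?_
          unfold AH.errG; have := hR0 T; positivity
      _ ≤ |C₂| * ((|α| + 1) * E1) := mul_le_mul_of_nonneg_left (hEle α) (abs_nonneg _)
      _ ≤ |C₂| * (3 * E1) := by gcongr; linarith
      _ = 3 * |C₂| * E1 := by ring
  have hcor1 : |(∫ α in (0 : ℝ)..2, G α) - 2 * P0| ≤ 6 * |C₂| * E1 := by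
    have e : (∫ α in (0 : ℝ)..2, ((G α : ℂ) - Sf α)) =
        (((∫ α in (0 : ℝ)..2, G α) - 2 * P0 : ℝ) : ℂ) := by
      rw [intervalIntegral.integral_sub hGC (hSfc.intervalIntegrable _ _), hSf_int,
        intervalIntegral.integral_ofReal]
      push_cast; ring
    rw [e, Complex.norm_real, Real.norm_eq_abs] at hdiff
    norm_num at hdiff
    linarith
  ---------------------------------------------------------------------------
  -- (Cor5-2): periodicity and evenness
  ---------------------------------------------------------------------------
  -- `|G(β + 2) − G(β)| ≤ 4|C₂|E1` for `|β| ≤ 1`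
  have hper : ∀ β : ℝ, |β| ≤ 1 → |G (β + 2) - G β| ≤ 4 * |C₂| * E1 := by
    intro β hβ
    have h := (hab2 β).2 1
    have e : β + 2 * ((1 : ℤ) : ℝ) = β + 2 := by norm_num
    rw [e] at h
    calc |G (β + 2) - G β| ≤ C₂ * AH.errG M (R T) T lam (|β| + 2 * |((1 : ℤ) : ℝ)|) := h
      _ ≤ |C₂| * AH.errG M (R T) T lam (|β| + 2 * |((1 : ℤ) : ℝ)|) := by
          refine mul_le_mul_of_nonneg_right (le_abs_self _) ?_
          unfold AH.errG; have := hR0 T; positivity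
      _ ≤ |C₂| * ((|(|β| + 2 * |((1 : ℤ) : ℝ)|)| + 1) * E1) :=
          mul_le_mul_of_nonneg_left (hEle _) (abs_nonneg _)
      _ ≤ |C₂| * (4 * E1) := by
          gcongr
          have : |(|β| + 2 * |((1 : ℤ) : ℝ)|)| = |β| + 2 := by
            rw [abs_of_nonneg (by positivity)]; norm_num
          rw [this]; linarith
      _ = 4 * |C₂| * E1 := by ring
  -- `∫_{2−λ}^{2} G = ∫_{−λ}^{0} G + θ₂`
  have hθ2 : |(∫ α in (2 - lam)..2, G α) - ∫ β in (-lam)..0, G β| ≤ 4 * |C₂| * E1 := by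
    have e : (∫ α in (2 - lam)..2, G α) = ∫ β in (-lam)..0, G (β + 2) := by
      rw [intervalIntegral.integral_comp_add_right G 2]
      congr 1 <;> ring
    have hGs : IntervalIntegrable (fun β : ℝ ↦ G (β + 2)) volume (-lam) 0 :=
      (hGc.comp (continuous_id.add continuous_const) : Continuous fun β : ℝ ↦ G (β + 2))
        |>.intervalIntegrable _ _
    rw [e, ← intervalIntegral.integral_sub hGs (hGi _ _)]
    have h := intervalIntegral.norm_integral_le_of_norm_le_const (a := -lam) (b := 0)
      (C := 4 * |C₂| * E1) (f := fun β ↦ G (β + 2) - G β) fun β hβ ↦ by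
        rw [Set.uIoc_of_le (by linarith)] at hβ
        rw [Real.norm_eq_abs]
        exact hper β (abs_le.mpr ⟨by linarith [hβ.1], by linarith [hβ.2]⟩)
    rw [Real.norm_eq_abs] at h
    refine h.trans ?_
    rw [show |(0 : ℝ) - -lam| = lam by rw [sub_neg_eq_add, zero_add, abs_of_pos hlam]]
    have : 0 ≤ 4 * |C₂| * E1 := by positivity
    nlinarith
  -- `∫_{1+λ}^{2−λ} G = ∫_{λ}^{1−λ} G + θ₃`
  have hθ3 : |(∫ α in (1 + lam)..(2 - lam), G α) - ∫ α in lam..(1 - lam), G α| ≤ 4 * |C₂| * E1 := by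
    have e1 : (∫ α in (1 + lam)..(2 - lam), G α) = ∫ β in (lam - 1)..(-lam), G (β + 2) := by
      rw [intervalIntegral.integral_comp_add_right G 2]
      congr 1 <;> ring
    have e2 : (∫ α in lam..(1 - lam), G α) = ∫ β in (lam - 1)..(-lam), G β := by
      have h := intervalIntegral.integral_comp_neg (a := lam) (b := 1 - lam) G
      have hev : (fun x ↦ G (-x)) = G := by
        funext x; simp only [hG]; exact AH.heathBrownG_neg lam x T
      rw [hev] at h
      rw [h]
      congr 1; ring
    have hGs : IntervalIntegrable (fun β : ℝ ↦ G (β + 2)) volume (lam - 1) (-lam) :=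
      (hGc.comp (continuous_id.add continuous_const) : Continuous fun β : ℝ ↦ G (β + 2))
        |>.intervalIntegrable _ _
    rw [e1, e2, ← intervalIntegral.integral_sub hGs (hGi _ _)]
    have h := intervalIntegral.norm_integral_le_of_norm_le_const (a := lam - 1) (b := -lam)
      (C := 4 * |C₂| * E1) (f := fun β ↦ G (β + 2) - G β) fun β hβ ↦ by
        rw [Set.uIoc_of_le (by linarith)] at hβ
        rw [Real.norm_eq_abs]
        exact hper β (abs_le.mpr ⟨by linarith [hβ.1], by linarith [hβ.2]⟩)
    rw [Real.norm_eq_abs] at h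
    refine h.trans ?_
    rw [show |-lam - (lam - 1)| = 1 - 2 * lam by
      rw [show -lam - (lam - 1) = 1 - 2 * lam by ring]; exact abs_of_pos (by linarith)]
    have : 0 ≤ 4 * |C₂| * E1 := by positivity
    nlinarith
  ---------------------------------------------------------------------------
  -- (Cor5-3): `|∫_{−λ}^{λ} G − 1| ≤ 2(|C₁| + 1)(λ² + Q + Q)·…`
  ---------------------------------------------------------------------------
  have hθ4 : |(∫ α in (-lam)..lam, G α) - 1| ≤ 2 * (|C₁| + 1) * (lam + 2 * Q) := by
    set e₁ : ℝ := lam + 1 / (lam * Real.sqrt (Real.log T)) + 1 / (lam ^ 2 * Real.log T) with he₁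
    have he₁0 : 0 ≤ e₁ := by positivity
    -- pointwise on `Ioc (−λ) λ`
    have hpt : ∀ α ∈ Set.uIoc (-lam) lam, ‖G α - (lam - |α|) / lam ^ 2‖ ≤ (|C₁| + 1) * e₁ := by
      intro α hα
      rw [Set.uIoc_of_le (by linarith)] at hα
      rw [Real.norm_eq_abs]
      rcases lt_or_eq_of_le hα.2 with hlt | heq
      · have hαabs : |α| < lam := abs_lt.mpr ⟨hα.1, hlt⟩
        calc |G α - (lam - |α|) / lam ^ 2| ≤ C₁ * e₁ := (hab1 α).1 hαabs
          _ ≤ |C₁| * e₁ := mul_le_mul_of_nonneg_right (le_abs_self _) he₁0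
          _ ≤ (|C₁| + 1) * e₁ := by nlinarith [abs_nonneg C₁]
      · rw [heq, abs_of_pos hlam, sub_self, zero_div, sub_zero]
        have h := (hab1 lam).2 (by rw [abs_of_pos hlam]) (by rw [abs_of_pos hlam]; linarith)
        rw [abs_of_pos hlam] at h
        have h' : |G lam - lam| ≤ |C₁| * (1 / Real.sqrt (Real.log T) + 1 / (lam ^ 2 * Real.log T)) :=
          h.trans (mul_le_mul_of_nonneg_right (le_abs_self _) (by positivity))
        have hcmp : 1 / Real.sqrt (Real.log T) + 1 / (lam ^ 2 * Real.log T) ≤ e₁ := by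
          rw [he₁]
          have : 1 / Real.sqrt (Real.log T) ≤ 1 / (lam * Real.sqrt (Real.log T)) := by
            apply div_le_div_of_nonneg_left zero_le_one (by positivity)
            calc lam * Real.sqrt (Real.log T) ≤ 1 * Real.sqrt (Real.log T) := by gcongr
              _ = _ := one_mul _
          linarith
        have hle1 : lam ≤ e₁ := by
          rw [he₁]
          have : 0 ≤ 1 / (lam * Real.sqrt (Real.log T)) := by positivity
          have : 0 ≤ 1 / (lam ^ 2 * Real.log T) := by positivity
          linarith
        have hC₁e : |C₁| * (1 / Real.sqrt (Real.log T) + 1 / (lam ^ 2 * Real.log T)) ≤ |C₁| * e₁ :=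
          mul_le_mul_of_nonneg_left hcmp (abs_nonneg _)
        have hb := abs_le.mp h'
        have hCe0 : 0 ≤ |C₁| * e₁ := mul_nonneg (abs_nonneg _) he₁0
        rw [abs_le]
        constructor <;> linarith
    have hint := intervalIntegral.norm_integral_le_of_norm_le_const hpt
    have htri : IntervalIntegrable (fun α : ℝ ↦ (lam - |α|) / lam ^ 2) volume (-lam) lam :=
      ((continuous_const.sub continuous_abs).div_const _ :
        Continuous fun α : ℝ ↦ (lam - |α|) / lam ^ 2).intervalIntegrable _ _
    rw [intervalIntegral.integral_sub (hGi _ _) htri,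
      AH.integral_triangle_div_sq hlam, Real.norm_eq_abs] at hint
    rw [show |lam - -lam| = 2 * lam by rw [sub_neg_eq_add, ← two_mul, abs_of_pos (by linarith)]] at hint
    refine hint.trans ?_
    -- `(|C₁|+1) e₁ · 2λ = 2(|C₁|+1)(λ² + 1/√L + 1/(λ L)) ≤ 2(|C₁|+1)(λ + 2Q)`
    have h1 : e₁ * lam ≤ lam + 2 * Q := by
      rw [he₁, add_mul, add_mul]
      have t1 : lam * lam ≤ lam := by nlinarith
      have t2 : 1 / (lam * Real.sqrt (Real.log T)) * lam = 1 / Real.sqrt (Real.log T) := by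
        field_simp
      have t3 : 1 / (lam ^ 2 * Real.log T) * lam = 1 / (lam * Real.log T) := by
        field_simp
      rw [t2, t3]
      linarith
    have hC0 : 0 ≤ |C₁| + 1 := by positivity
    calc (|C₁| + 1) * e₁ * (2 * lam) = 2 * (|C₁| + 1) * (e₁ * lam) := by ring
      _ ≤ 2 * (|C₁| + 1) * (lam + 2 * Q) := by gcongr
  ---------------------------------------------------------------------------
  -- (Cor5-4): `|∫_{λ}^{1−λ} G − (1/2 − λ)| ≤ 2|C₁| Q`
  ---------------------------------------------------------------------------
  have hθ5 : |(∫ α in lam..(1 - lam), G α) - (1 / 2 - lam)| ≤ 2 * |C₁| * Q := by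
    set e₂ : ℝ := 1 / Real.sqrt (Real.log T) + 1 / (lam ^ 2 * Real.log T) with he₂
    have he₂0 : 0 ≤ e₂ := by positivity
    have hpt : ∀ α ∈ Set.uIoc lam (1 - lam), ‖G α - α‖ ≤ |C₁| * e₂ := by
      intro α hα
      rw [Set.uIoc_of_le (by linarith)] at hα
      have hα0 : 0 < α := by linarith [hα.1]
      have h := (hab1 α).2 (by rw [abs_of_pos hα0]; exact hα.1.le) (by rw [abs_of_pos hα0]; exact hα.2)
      rw [abs_of_pos hα0] at h
      rw [Real.norm_eq_abs]
      exact h.trans (mul_le_mul_of_nonneg_right (le_abs_self _) he₂0)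
    have hint := intervalIntegral.norm_integral_le_of_norm_le_const hpt
    have hid' : IntervalIntegrable (fun x : ℝ ↦ x) volume lam (1 - lam) :=
      (continuous_id : Continuous fun x : ℝ ↦ x).intervalIntegrable _ _
    rw [intervalIntegral.integral_sub (hGi _ _) hid', integral_id, Real.norm_eq_abs] at hint
    have e : ((1 - lam) ^ 2 - lam ^ 2) / 2 = 1 / 2 - lam := by ring
    rw [e, show |1 - lam - lam| = 1 - 2 * lam by
      rw [show 1 - lam - lam = 1 - 2 * lam by ring]; exact abs_of_pos (by linarith)] at hint
    refine hint.trans ?_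
    have h1 : e₂ ≤ 2 * Q := by rw [he₂]; linarith
    have hC0 : 0 ≤ |C₁| := abs_nonneg _
    calc |C₁| * e₂ * (1 - 2 * lam) ≤ |C₁| * e₂ * 1 := by
          apply mul_le_mul_of_nonneg_left (by linarith) (by positivity)
      _ ≤ |C₁| * (2 * Q) * 1 := by gcongr
      _ = 2 * |C₁| * Q := by ring
  ---------------------------------------------------------------------------
  -- assembly
  ---------------------------------------------------------------------------
  have hsplit : (∫ α in (0 : ℝ)..2, G α) =
      (∫ α in (0 : ℝ)..lam, G α) + (∫ α in lam..(1 - lam), G α) +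
        (∫ α in (1 - lam)..(1 + lam), G α) + (∫ α in (1 + lam)..(2 - lam), G α) +
        (∫ α in (2 - lam)..2, G α) := by
    rw [intervalIntegral.integral_add_adjacent_intervals (hGi _ _) (hGi _ _),
      intervalIntegral.integral_add_adjacent_intervals (hGi _ _) (hGi _ _),
      intervalIntegral.integral_add_adjacent_intervals (hGi _ _) (hGi _ _),
      intervalIntegral.integral_add_adjacent_intervals (hGi _ _) (hGi _ _)]
  have hsym : (∫ α in (-lam)..lam, G α) = (∫ α in (-lam)..0, G α) + ∫ α in (0 : ℝ)..lam, G α :=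
    (intervalIntegral.integral_add_adjacent_intervals (hGi _ _) (hGi _ _)).symm
  -- the identity
  have hid : (∫ α in (1 - lam)..(1 + lam), G α) - 2 * (P0 - 1) =
      ((∫ α in (0 : ℝ)..2, G α) - 2 * P0) - ((∫ α in (-lam)..lam, G α) - 1) -
        2 * ((∫ α in lam..(1 - lam), G α) - (1 / 2 - lam)) -
        ((∫ α in (2 - lam)..2, G α) - ∫ β in (-lam)..0, G β) -
        ((∫ α in (1 + lam)..(2 - lam), G α) - ∫ α in lam..(1 - lam), G α) + 2 * lam := by
    rw [hsplit, hsym]; ring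
  rw [hid]
  have b1 := abs_le.mp hcor1
  have b2 := abs_le.mp hθ4
  have b3 := abs_le.mp hθ5
  have b4 := abs_le.mp hθ2
  have b5 := abs_le.mp hθ3
  have hfin : 6 * |C₂| * E1 + 2 * (|C₁| + 1) * (lam + 2 * Q) + 2 * (2 * |C₁| * Q) +
      4 * |C₂| * E1 + 4 * |C₂| * E1 + 2 * lam ≤
      (14 * |C₂| + 8 * |C₁| + 6) * (lam + E1 + Q) := by
    have hA : 0 ≤ |C₁| := abs_nonneg _
    have hB : 0 ≤ |C₂| := abs_nonneg _
    have d : (14 * |C₂| + 8 * |C₁| + 6) * (lam + E1 + Q) -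
        (6 * |C₂| * E1 + 2 * (|C₁| + 1) * (lam + 2 * Q) + 2 * (2 * |C₁| * Q) +
          4 * |C₂| * E1 + 4 * |C₂| * E1 + 2 * lam) =
        14 * (|C₂| * lam) + 14 * (|C₂| * Q) + 6 * (|C₁| * lam) + 8 * (|C₁| * E1) + 2 * lam +
          6 * E1 + 2 * Q := by ring
    have p1 : 0 ≤ |C₂| * lam := mul_nonneg hB hlam.le
    have p2 : 0 ≤ |C₂| * Q := mul_nonneg hB hQ0
    have p3 : 0 ≤ |C₁| * lam := mul_nonneg hA hlam.le
    have p4 : 0 ≤ |C₁| * E1 := mul_nonneg hA hE10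
    linarith only [d, p1, p2, p3, p4, hlam.le, hE10, hQ0]
  rw [abs_le]
  constructor <;>
    linarith only [b1.1, b1.2, b2.1, b2.2, b3.1, b3.2, b4.1, b4.2, b5.1, b5.2, hfin, hlam.le]

/-! ## v2 (appended 2026-08-26, seat t6 g3): Lemma 5 (i)–(ii) from (MT); discharges -/

namespace AH

/-! ### Helpers for Lemma 5 (i)–(ii) -/

/-- `∫_a^b e^{cx} dx = (e^{cb} − e^{ca})/c` (`c ≠ 0`). [folklore] -/
private theorem integral_exp_mul {c : ℝ} (hc : c ≠ 0) (a b : ℝ) :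
    ∫ x in a..b, Real.exp (c * x) = (Real.exp (c * b) - Real.exp (c * a)) / c := by
  rw [intervalIntegral.integral_comp_mul_left (fun x ↦ Real.exp x) hc, integral_exp, smul_eq_mul,
    inv_mul_eq_div]

/-- `y e^{−y} ≤ 1`. [folklore] -/
private theorem mul_exp_neg_le_one (y : ℝ) : y * Real.exp (-y) ≤ 1 := by
  have h := Real.add_one_le_exp y
  have hpos := Real.exp_pos (-y)
  have h1 : y * Real.exp (-y) ≤ Real.exp y * Real.exp (-y) :=
    mul_le_mul_of_nonneg_right (by linarith) hpos.le
  rwa [← Real.exp_add, add_neg_cancel, Real.exp_zero] at h1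

/-- `|u| · L e^{−2L|u|} ≤ e^{−L|u|}` (`L ≥ 0`). [folklore] -/
private theorem abs_mul_expKernel_le (L u : ℝ) :
    |u| * (L * Real.exp (-(2 * L) * |u|)) ≤ Real.exp (-L * |u|) := by
  have h := mul_exp_neg_le_one (L * |u|)
  have hpos := Real.exp_pos (-L * |u|)
  have e : Real.exp (-(2 * L) * |u|) = Real.exp (-(L * |u|)) * Real.exp (-L * |u|) := by
    rw [← Real.exp_add]; ring_nf
  rw [e]
  calc |u| * (L * (Real.exp (-(L * |u|)) * Real.exp (-L * |u|)))
      = (L * |u| * Real.exp (-(L * |u|))) * Real.exp (-L * |u|) := by ring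
    _ ≤ 1 * Real.exp (-L * |u|) := mul_le_mul_of_nonneg_right h hpos.le
    _ = Real.exp (-L * |u|) := one_mul _

/-- `x e^{−2Lx} ≤ 1/(2L)` for `L > 0`. [folklore] -/
private theorem mul_exp_neg_two_mul_le {L : ℝ} (hL : 0 < L) (x : ℝ) :
    x * Real.exp (-(2 * L) * x) ≤ 1 / (2 * L) := by
  have h := mul_exp_neg_le_one (2 * L * x)
  rw [le_div_iff₀ (by positivity)]
  calc x * Real.exp (-(2 * L) * x) * (2 * L) = 2 * L * x * Real.exp (-(2 * L * x)) := by ring_nf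
    _ ≤ 1 := h

/-- `∫_p^q e^{−c|u|} du = (2 − e^{cp} − e^{−cq})/c` for `p ≤ 0 ≤ q`, `c > 0`. [folklore] -/
private theorem integral_exp_neg_mul_abs {c p q : ℝ} (hc : 0 < c) (hp : p ≤ 0) (hq : 0 ≤ q) :
    ∫ u in p..q, Real.exp (-c * |u|) = (2 - Real.exp (c * p) - Real.exp (-c * q)) / c := by
  have hcont : Continuous fun u : ℝ ↦ Real.exp (-c * |u|) := by fun_prop
  rw [← integral_add_adjacent_intervals (b := 0) (hcont.intervalIntegrable _ _)
    (hcont.intervalIntegrable _ _)]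
  have h1 : ∫ u in p..0, Real.exp (-c * |u|) = ∫ u in p..0, Real.exp (c * u) := by
    refine integral_congr fun u hu ↦ ?_
    rw [Set.uIcc_of_le hp] at hu
    simp only [abs_of_nonpos hu.2]; ring_nf
  have h2 : ∫ u in (0 : ℝ)..q, Real.exp (-c * |u|) = ∫ u in (0 : ℝ)..q, Real.exp (-c * u) := by
    refine integral_congr fun u hu ↦ ?_
    rw [Set.uIcc_of_le hq] at hu
    simp only [abs_of_nonneg hu.1]
  rw [h1, h2, integral_exp_mul hc.ne', integral_exp_mul (by linarith : -c ≠ 0)]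
  simp only [mul_zero, Real.exp_zero]
  field_simp
  ring

/-- `∫_p^q e^{−cu} du ≤ 1/c` for `0 ≤ p ≤ q`... in fact for `0 ≤ p` and any `q ≥ p`. [folklore] -/
private theorem integral_exp_neg_mul_le {c p : ℝ} (q : ℝ) (hc : 0 < c) (hp : 0 ≤ p) :
    ∫ u in p..q, Real.exp (-c * u) ≤ 1 / c := by
  rw [integral_exp_mul (by linarith : -c ≠ 0)]
  have h1 : Real.exp (-c * p) ≤ 1 := by
    rw [← Real.exp_zero]; exact Real.exp_le_exp.mpr (by nlinarith)
  have h2 : 0 < Real.exp (-c * q) := Real.exp_pos _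
  rw [div_neg, ← neg_div, neg_sub, div_le_div_iff_of_pos_right hc]
  linarith

/-- `∫_{−λ}^{λ} (λ − |β|) dβ = λ²`. [folklore] -/
private theorem integral_triangle {lam : ℝ} (hlam : 0 < lam) :
    ∫ β in (-lam)..lam, (lam - |β|) = lam ^ 2 := by
  have h := integral_triangle_div_sq hlam
  have e : (fun β : ℝ ↦ lam - |β|) = fun β ↦ lam ^ 2 * ((lam - |β|) / lam ^ 2) := by
    funext β; field_simp
  rw [e, intervalIntegral.integral_const_mul, h, mul_one]

/-- `∫_{−λ}^{λ} (λ − |β|) β dβ = 0` (odd integrand). [folklore] -/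
private theorem integral_triangle_mul_id (lam : ℝ) :
    ∫ β in (-lam)..lam, (lam - |β|) * β = 0 := by
  have h := intervalIntegral.integral_comp_neg (a := -lam) (b := lam)
    (fun β : ℝ ↦ (lam - |β|) * β)
  simp only [neg_neg, abs_neg, mul_neg, intervalIntegral.integral_neg] at h
  linarith

/-! ### The kernel `w(β) = L e^{−2L|a+β|}` against the triangle `λ − |β|` -/

/-- `J := ∫_{−λ}^{λ} L e^{−2L|a+β|} dβ = 1 − (e^{−2L(λ−a)} + e^{−2L(λ+a)})/2` when `a − λ ≤ 0 ≤ a +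
λ`. [cite: BaluyotGoldstonSuriajayaTurnageButterbaugh2025, §5 proof of Lemma 5 (i)–(ii)
(lem4proof)] -/
private theorem integral_expKernel {L lam a : ℝ} (hL : 0 < L) (hlo : a - lam ≤ 0) (hhi : 0 ≤ a + lam) :
    ∫ β in (-lam)..lam, L * Real.exp (-(2 * L) * |a + β|) =
      1 - (Real.exp (-(2 * L) * (lam - a)) + Real.exp (-(2 * L) * (lam + a))) / 2 := by
  rw [intervalIntegral.integral_const_mul,
    intervalIntegral.integral_comp_add_left (fun u ↦ Real.exp (-(2 * L) * |u|)) a, ← sub_eq_add_neg,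
    integral_exp_neg_mul_abs (by positivity) hlo hhi]
  have e1 : Real.exp (2 * L * (a - lam)) = Real.exp (-(2 * L) * (lam - a)) := by ring_nf
  have e2 : Real.exp (-(2 * L) * (a + lam)) = Real.exp (-(2 * L) * (lam + a)) := by ring_nf
  rw [e1, e2]
  field_simp
  ring

/-- `∫_{−λ}^{λ} e^{−L|a+β|} dβ ≤ 2/L` when `a − λ ≤ 0 ≤ a + λ`. [folklore] -/
private theorem integral_exp_abs_shift_le {L lam a : ℝ} (hL : 0 < L) (hlo : a - lam ≤ 0)
    (hhi : 0 ≤ a + lam) :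
    ∫ β in (-lam)..lam, Real.exp (-L * |a + β|) ≤ 2 / L := by
  rw [intervalIntegral.integral_comp_add_left (fun u ↦ Real.exp (-L * |u|)) a, ← sub_eq_add_neg,
    integral_exp_neg_mul_abs hL hlo hhi]
  have h1 := Real.exp_pos (L * (a - lam))
  have h2 := Real.exp_pos (-L * (a + lam))
  rw [div_le_div_iff_of_pos_right hL]
  linarith

/-- `∫_{−λ}^{λ} e^{−L(a+β)} dβ ≤ 1/L` when `λ ≤ a`. [folklore] -/
private theorem integral_exp_shift_le {L lam a : ℝ} (hL : 0 < L) (hla : lam ≤ a) :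
    ∫ β in (-lam)..lam, Real.exp (-L * (a + β)) ≤ 1 / L := by
  rw [intervalIntegral.integral_comp_add_left (fun u ↦ Real.exp (-L * u)) a]
  exact integral_exp_neg_mul_le _ hL (by linarith)

/-- Near range (`0 ≤ a ≤ λ`): `|∫_{−λ}^{λ} (λ − |β|) L e^{−2L|a+β|} dβ − (λ − a)| ≤ 5/(2L)`
(BGSTB: "the integrals here are all elementary … = (λ−α)/λ²·λ² + O(1/log T)"). [cite:
BaluyotGoldstonSuriajayaTurnageButterbaugh2025, §5 proof of Lemma 5 (i)–(ii) (lem4proof)] -/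
private theorem integral_triangle_mul_expKernel_near {L lam a : ℝ} (hL : 0 < L) (hlam : 0 < lam)
    (ha : 0 ≤ a) (hal : a ≤ lam) :
    |(∫ β in (-lam)..lam, (lam - |β|) * (L * Real.exp (-(2 * L) * |a + β|))) - (lam - a)| ≤
      5 / (2 * L) := by
  have hwc : Continuous fun β : ℝ ↦ L * Real.exp (-(2 * L) * |a + β|) := by fun_prop
  have i1 : IntervalIntegrable (fun β : ℝ ↦ (a - |β|) * (L * Real.exp (-(2 * L) * |a + β|)))
      volume (-lam) lam := by apply Continuous.intervalIntegrable; fun_prop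
  have i2 : IntervalIntegrable (fun β : ℝ ↦ (lam - a) * (L * Real.exp (-(2 * L) * |a + β|)))
      volume (-lam) lam := by apply Continuous.intervalIntegrable; fun_prop
  have hsplit : (∫ β in (-lam)..lam, (lam - |β|) * (L * Real.exp (-(2 * L) * |a + β|))) =
      (∫ β in (-lam)..lam, (a - |β|) * (L * Real.exp (-(2 * L) * |a + β|))) +
        (lam - a) * ∫ β in (-lam)..lam, L * Real.exp (-(2 * L) * |a + β|) := by
    rw [← intervalIntegral.integral_const_mul, ← intervalIntegral.integral_add i1 i2]
    refine intervalIntegral.integral_congr fun β _ ↦ ?_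
    ring
  have hJ := integral_expKernel hL (by linarith : a - lam ≤ 0) (by linarith : 0 ≤ a + lam)
  -- the odd-ish part
  have hD : |∫ β in (-lam)..lam, (a - |β|) * (L * Real.exp (-(2 * L) * |a + β|))| ≤ 2 / L := by
    have hb := intervalIntegral.norm_integral_le_of_norm_le (μ := volume)
      (f := fun β : ℝ ↦ (a - |β|) * (L * Real.exp (-(2 * L) * |a + β|)))
      (g := fun β : ℝ ↦ Real.exp (-L * |a + β|)) (by linarith : -lam ≤ lam)
      (ae_of_all _ fun β _ ↦ ?_) ((by fun_prop : Continuous fun β : ℝ ↦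
        Real.exp (-L * |a + β|)).intervalIntegrable _ _)
    · rw [Real.norm_eq_abs] at hb
      exact hb.trans (integral_exp_abs_shift_le hL (by linarith) (by linarith))
    · rw [Real.norm_eq_abs, abs_mul, abs_of_nonneg (by positivity : 0 ≤ L * Real.exp (-(2 * L) * |a + β|))]
      have h1 : abs (a - |β|) ≤ |a + β| := by
        have := abs_abs_sub_abs_le_abs_sub a (-β)
        rwa [abs_neg, sub_neg_eq_add, abs_of_nonneg ha] at this
      calc abs (a - |β|) * (L * Real.exp (-(2 * L) * |a + β|))
          ≤ |a + β| * (L * Real.exp (-(2 * L) * |a + β|)) :=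
            mul_le_mul_of_nonneg_right h1 (by positivity)
        _ ≤ Real.exp (-L * |a + β|) := abs_mul_expKernel_le L (a + β)
  -- the boundary terms
  have hB1 : (lam - a) * Real.exp (-(2 * L) * (lam - a)) ≤ 1 / (2 * L) :=
    mul_exp_neg_two_mul_le hL (lam - a)
  have hB2 : (lam - a) * Real.exp (-(2 * L) * (lam + a)) ≤ 1 / (2 * L) := by
    have h := mul_exp_neg_two_mul_le hL (lam + a)
    have hpos := Real.exp_pos (-(2 * L) * (lam + a))
    nlinarith
  have hB0 : 0 ≤ (lam - a) * (Real.exp (-(2 * L) * (lam - a)) + Real.exp (-(2 * L) * (lam + a))) := by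
    have := Real.exp_pos (-(2 * L) * (lam - a))
    have := Real.exp_pos (-(2 * L) * (lam + a))
    have : 0 ≤ lam - a := by linarith
    positivity
  rw [hsplit, hJ]
  have e : (∫ β in (-lam)..lam, (a - |β|) * (L * Real.exp (-(2 * L) * |a + β|))) +
      (lam - a) * (1 - (Real.exp (-(2 * L) * (lam - a)) + Real.exp (-(2 * L) * (lam + a))) / 2) -
      (lam - a) =
      (∫ β in (-lam)..lam, (a - |β|) * (L * Real.exp (-(2 * L) * |a + β|))) -
        (lam - a) * (Real.exp (-(2 * L) * (lam - a)) + Real.exp (-(2 * L) * (lam + a))) / 2 := by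
    ring
  rw [e]
  have hB0' : 0 ≤ (lam - a) * (Real.exp (-(2 * L) * (lam - a)) +
      Real.exp (-(2 * L) * (lam + a))) / 2 := by positivity
  calc |(∫ β in (-lam)..lam, (a - |β|) * (L * Real.exp (-(2 * L) * |a + β|))) -
        (lam - a) * (Real.exp (-(2 * L) * (lam - a)) + Real.exp (-(2 * L) * (lam + a))) / 2|
      ≤ |∫ β in (-lam)..lam, (a - |β|) * (L * Real.exp (-(2 * L) * |a + β|))| +
        |(lam - a) * (Real.exp (-(2 * L) * (lam - a)) + Real.exp (-(2 * L) * (lam + a))) / 2| :=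
        abs_sub _ _
    _ ≤ 2 / L + 1 / (2 * L) := by
        refine add_le_add hD ?_
        rw [abs_of_nonneg hB0']
        linarith
    _ = 5 / (2 * L) := by
        field_simp
        norm_num

/-- `0 ≤ ∫_{−λ}^{λ} (λ − |β|) L e^{−2L|a+β|} dβ`. [cite:
BaluyotGoldstonSuriajayaTurnageButterbaugh2025, §5 proof of Lemma 5 (i)–(ii) (lem4proof)] -/
private theorem integral_triangle_mul_expKernel_nonneg {L lam a : ℝ} (hL : 0 < L) (hlam : 0 < lam) :
    0 ≤ ∫ β in (-lam)..lam, (lam - |β|) * (L * Real.exp (-(2 * L) * |a + β|)) := by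
  refine intervalIntegral.integral_nonneg (by linarith) fun β hβ ↦ ?_
  have : |β| ≤ lam := abs_le.mpr ⟨by linarith [hβ.1], hβ.2⟩
  have : 0 ≤ lam - |β| := by linarith
  positivity

/-- `∫_{−λ}^{λ} (λ − |β|) L e^{−2L|a+β|} dβ ≤ λ` when `a − λ ≤ 0 ≤ a + λ`. [cite:
BaluyotGoldstonSuriajayaTurnageButterbaugh2025, §5 proof of Lemma 5 (i)–(ii) (lem4proof)] -/
private theorem integral_triangle_mul_expKernel_le {L lam a : ℝ} (hL : 0 < L) (hlam : 0 < lam)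
    (hlo : a - lam ≤ 0) (hhi : 0 ≤ a + lam) :
    (∫ β in (-lam)..lam, (lam - |β|) * (L * Real.exp (-(2 * L) * |a + β|))) ≤ lam := by
  have hJ := integral_expKernel hL hlo hhi
  have i1 : IntervalIntegrable (fun β : ℝ ↦ (lam - |β|) * (L * Real.exp (-(2 * L) * |a + β|)))
      volume (-lam) lam := by apply Continuous.intervalIntegrable; fun_prop
  have i2 : IntervalIntegrable (fun β : ℝ ↦ lam * (L * Real.exp (-(2 * L) * |a + β|)))
      volume (-lam) lam := by apply Continuous.intervalIntegrable; fun_prop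
  have hle := intervalIntegral.integral_mono_on (by linarith : -lam ≤ lam) i1 i2 fun β _ ↦ by
    have : 0 ≤ |β| := abs_nonneg β
    exact mul_le_mul_of_nonneg_right (by linarith) (by positivity)
  refine hle.trans ?_
  rw [intervalIntegral.integral_const_mul, hJ]
  have := Real.exp_pos (-(2 * L) * (lam - a))
  have := Real.exp_pos (-(2 * L) * (lam + a))
  nlinarith

/-- Far range (`λ ≤ a`): `∫_{−λ}^{λ} (λ − |β|) L e^{−2L|a+β|} dβ ≤ 1/L`
(BGSTB: "= (T^{−2(α−λ)} − 2T^{−2α} + T^{−2(α+λ)})/(4λ² log T)·λ² = O(1/log T)"). [cite: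
BaluyotGoldstonSuriajayaTurnageButterbaugh2025, §5 proof of Lemma 5 (i)–(ii) (lem4proof)] -/
private theorem integral_triangle_mul_expKernel_far {L lam a : ℝ} (hL : 0 < L) (hlam : 0 < lam)
    (hla : lam ≤ a) :
    (∫ β in (-lam)..lam, (lam - |β|) * (L * Real.exp (-(2 * L) * |a + β|))) ≤ 1 / L := by
  have i1 : IntervalIntegrable (fun β : ℝ ↦ (lam - |β|) * (L * Real.exp (-(2 * L) * |a + β|)))
      volume (-lam) lam := by apply Continuous.intervalIntegrable; fun_prop
  have i2 : IntervalIntegrable (fun β : ℝ ↦ Real.exp (-L * (a + β))) volume (-lam) lam := by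
    apply Continuous.intervalIntegrable; fun_prop
  have hle := intervalIntegral.integral_mono_on (by linarith : -lam ≤ lam) i1 i2 fun β hβ ↦ by
    have hab : 0 ≤ a + β := by linarith [hβ.1]
    have h1 : lam - |β| ≤ |a + β| := by
      rw [abs_of_nonneg hab]; linarith [neg_le_abs β]
    calc (lam - |β|) * (L * Real.exp (-(2 * L) * |a + β|))
        ≤ |a + β| * (L * Real.exp (-(2 * L) * |a + β|)) :=
          mul_le_mul_of_nonneg_right h1 (by positivity)
      _ ≤ Real.exp (-L * |a + β|) := abs_mul_expKernel_le L (a + β)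
      _ = Real.exp (-L * (a + β)) := by rw [abs_of_nonneg hab]
  exact hle.trans (integral_exp_shift_le hL hla)

/-- Far range: `∫_{−λ}^{λ} (λ − |β|)|a + β| dβ = a λ²` when `λ ≤ a` (BGSTB: "= α(2/λ² ∫_0^λ
(λ−β)dβ)·λ² = αλ²"). [cite: BaluyotGoldstonSuriajayaTurnageButterbaugh2025, §5 proof of Lemma 5
(i)–(ii) (lem4proof)] -/
private theorem integral_triangle_mul_abs_far {lam a : ℝ} (hlam : 0 < lam) (hla : lam ≤ a) :
    ∫ β in (-lam)..lam, (lam - |β|) * |a + β| = a * lam ^ 2 := by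
  have h1 : ∫ β in (-lam)..lam, (lam - |β|) * |a + β| =
      ∫ β in (-lam)..lam, (a * (lam - |β|) + (lam - |β|) * β) := by
    refine intervalIntegral.integral_congr fun β hβ ↦ ?_
    rw [Set.uIcc_of_le (by linarith)] at hβ
    rw [abs_of_nonneg (by linarith [hβ.1] : 0 ≤ a + β)]
    ring
  have i1 : IntervalIntegrable (fun β : ℝ ↦ a * (lam - |β|)) volume (-lam) lam := by
    apply Continuous.intervalIntegrable; fun_prop
  have i2 : IntervalIntegrable (fun β : ℝ ↦ (lam - |β|) * β) volume (-lam) lam := by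
    apply Continuous.intervalIntegrable; fun_prop
  rw [h1, intervalIntegral.integral_add i1 i2, intervalIntegral.integral_const_mul,
    integral_triangle hlam, integral_triangle_mul_id]
  ring

/-- Near range: `0 ≤ ∫_{−λ}^{λ} (λ − |β|)|a + β| dβ ≤ 4λ³` when `0 ≤ a ≤ λ` (BGSTB: "≪ λ³"). [cite:
BaluyotGoldstonSuriajayaTurnageButterbaugh2025, §5 proof of Lemma 5 (i)–(ii) (lem4proof)] -/
private theorem integral_triangle_mul_abs_near {lam a : ℝ} (hlam : 0 < lam) (ha : 0 ≤ a)
    (hal : a ≤ lam) :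
    0 ≤ ∫ β in (-lam)..lam, (lam - |β|) * |a + β| ∧
      ∫ β in (-lam)..lam, (lam - |β|) * |a + β| ≤ 4 * lam ^ 3 := by
  constructor
  · refine intervalIntegral.integral_nonneg (by linarith) fun β hβ ↦ ?_
    have : |β| ≤ lam := abs_le.mpr ⟨by linarith [hβ.1], hβ.2⟩
    have : 0 ≤ lam - |β| := by linarith
    positivity
  · have i1 : IntervalIntegrable (fun β : ℝ ↦ (lam - |β|) * |a + β|) volume (-lam) lam := by
      apply Continuous.intervalIntegrable; fun_prop
    have i2 : IntervalIntegrable (fun _ : ℝ ↦ 2 * lam ^ 2) volume (-lam) lam :=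
      continuous_const.intervalIntegrable _ _
    have hle := intervalIntegral.integral_mono_on (by linarith : -lam ≤ lam) i1 i2 fun β hβ ↦ by
      have h1 : |β| ≤ lam := abs_le.mpr ⟨by linarith [hβ.1], hβ.2⟩
      have h2 : 0 ≤ lam - |β| := by linarith
      have h3 : |a + β| ≤ 2 * lam := by
        refine (abs_add_le _ _).trans ?_; rw [abs_of_nonneg ha]; linarith
      have h4 : 0 ≤ |β| := abs_nonneg β
      calc (lam - |β|) * |a + β| ≤ lam * (2 * lam) :=
            mul_le_mul (by linarith) h3 (abs_nonneg _) hlam.le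
        _ = 2 * lam ^ 2 := by ring
    refine hle.trans ?_
    rw [intervalIntegral.integral_const, smul_eq_mul]
    nlinarith

/-! ### Lemma 5 (i)–(ii): the decomposition under (MT) and the two ranges -/

/-- Decomposition of `λ² G_λ(a)` at height `T` under (MT) in the form
`|F(u) − (L e^{−2L|u|} + |u|)| ≤ C₀ (L e^{−2L|u|} + 1)/S` (`|u| ≤ 1`; `L = log T`, `S = √log T`):
`λ² G_λ(a) = ∫(λ−|β|) L e^{−2L|a+β|} + ∫(λ−|β|)|a+β| + E`, `|E| ≤ (C₀/S)(∫(λ−|β|) L e^{−2L|a+β|} +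
λ²)`
(BGSTB §5, (lem4proof): "by (MT) we have from (G_λ) that `G_λ(α) = (1 + O(1/√log T))(…) + O(1/√log
T)`"). [cite: BaluyotGoldstonSuriajayaTurnageButterbaugh2025, §5 proof of Lemma 5 (i)–(ii)
(lem4proof)] -/
private theorem heathBrownG_decomp {T L S C₀ lam a : ℝ}
    (hMT : ∀ u : ℝ, |u| ≤ 1 →
      |montgomeryFormFactor u T - (L * Real.exp (-(2 * L) * |u|) + |u|)| ≤
        C₀ * (L * Real.exp (-(2 * L) * |u|) + 1) / S)
    (hlam : 0 < lam) (hlo : -1 ≤ a - lam) (hhi : a + lam ≤ 1) :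
    |lam ^ 2 * heathBrownG lam a T -
        (∫ β in (-lam)..lam, (lam - |β|) * (L * Real.exp (-(2 * L) * |a + β|))) -
        (∫ β in (-lam)..lam, (lam - |β|) * |a + β|)| ≤
      C₀ / S * ((∫ β in (-lam)..lam, (lam - |β|) * (L * Real.exp (-(2 * L) * |a + β|))) +
        lam ^ 2) := by
  have hFc : Continuous fun β : ℝ ↦ montgomeryFormFactor (a + β) T :=
    (RudnickSarnak.continuous_montgomeryFormFactor T).comp (continuous_const.add continuous_id)
  have i1 : IntervalIntegrable (fun β : ℝ ↦ (lam - |β|) * montgomeryFormFactor (a + β) T)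
      volume (-lam) lam :=
    ((continuous_const.sub continuous_abs).mul hFc).intervalIntegrable _ _
  have i2 : IntervalIntegrable (fun β : ℝ ↦ (lam - |β|) * (L * Real.exp (-(2 * L) * |a + β|)))
      volume (-lam) lam := by
    apply Continuous.intervalIntegrable; fun_prop
  have i3 : IntervalIntegrable (fun β : ℝ ↦ (lam - |β|) * |a + β|) volume (-lam) lam := by
    apply Continuous.intervalIntegrable; fun_prop
  have i4 : IntervalIntegrable (fun β : ℝ ↦
      C₀ / S * ((lam - |β|) * (L * Real.exp (-(2 * L) * |a + β|)) + (lam - |β|)))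
      volume (-lam) lam := by
    apply Continuous.intervalIntegrable; fun_prop
  have i5 : IntervalIntegrable (fun β : ℝ ↦ lam - |β|) volume (-lam) lam := by
    apply Continuous.intervalIntegrable; fun_prop
  have hG : lam ^ 2 * heathBrownG lam a T =
      ∫ β in (-lam)..lam, (lam - |β|) * montgomeryFormFactor (a + β) T := by
    unfold heathBrownG
    rw [← mul_assoc, show lam ^ 2 * (1 / lam ^ 2) = 1 by field_simp, one_mul]
  rw [hG, ← intervalIntegral.integral_sub i1 i2, ← intervalIntegral.integral_sub (i1.sub i2) i3]
  have hb := intervalIntegral.norm_integral_le_of_norm_le (μ := volume)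
      (f := fun β : ℝ ↦ (lam - |β|) * montgomeryFormFactor (a + β) T -
        (lam - |β|) * (L * Real.exp (-(2 * L) * |a + β|)) - (lam - |β|) * |a + β|)
      (g := fun β : ℝ ↦
        C₀ / S * ((lam - |β|) * (L * Real.exp (-(2 * L) * |a + β|)) + (lam - |β|)))
      (by linarith : -lam ≤ lam) (ae_of_all _ fun β hβ ↦ ?_) i4
  · rw [Real.norm_eq_abs] at hb
    refine hb.trans (le_of_eq ?_)
    rw [intervalIntegral.integral_const_mul, intervalIntegral.integral_add i2 i5,
      integral_triangle hlam]
  · have hβ' : |β| ≤ lam := abs_le.mpr ⟨by linarith [hβ.1], hβ.2⟩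
    have hk : 0 ≤ lam - |β| := by linarith
    have hu : |a + β| ≤ 1 := abs_le.mpr ⟨by linarith [hβ.1], by linarith [hβ.2]⟩
    have hr := hMT (a + β) hu
    rw [Real.norm_eq_abs,
      show (lam - |β|) * montgomeryFormFactor (a + β) T -
          (lam - |β|) * (L * Real.exp (-(2 * L) * |a + β|)) - (lam - |β|) * |a + β| =
        (lam - |β|) * (montgomeryFormFactor (a + β) T -
          (L * Real.exp (-(2 * L) * |a + β|) + |a + β|)) by ring,
      abs_mul, abs_of_nonneg hk]
    calc (lam - |β|) * |montgomeryFormFactor (a + β) T -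
          (L * Real.exp (-(2 * L) * |a + β|) + |a + β|)|
        ≤ (lam - |β|) * (C₀ * (L * Real.exp (-(2 * L) * |a + β|) + 1) / S) :=
          mul_le_mul_of_nonneg_left hr hk
      _ = C₀ / S * ((lam - |β|) * (L * Real.exp (-(2 * L) * |a + β|)) + (lam - |β|)) := by
          ring

/-- Lemma 5 (i), core estimate at `0 ≤ a ≤ λ ≤ 1/2` (BGSTB §5, proof of (lem4-i)). [cite:
BaluyotGoldstonSuriajayaTurnageButterbaugh2025, §5 proof of Lemma 5 (i)–(ii) (lem4proof)] -/
private theorem heathBrownG_near_core {T L S C₀ lam a : ℝ} (hL1 : 1 ≤ L) (hS1 : 1 ≤ S)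
    (hC₀ : 0 ≤ C₀)
    (hMT : ∀ u : ℝ, |u| ≤ 1 →
      |montgomeryFormFactor u T - (L * Real.exp (-(2 * L) * |u|) + |u|)| ≤
        C₀ * (L * Real.exp (-(2 * L) * |u|) + 1) / S)
    (hlam : 0 < lam) (hlam2 : lam ≤ 1 / 2) (ha : 0 ≤ a) (hal : a ≤ lam) :
    |heathBrownG lam a T - (lam - a) / lam ^ 2| ≤
      (2 * C₀ + 4) * (lam + 1 / (lam * S) + 1 / (lam ^ 2 * L)) := by
  have hL : 0 < L := by linarith
  have hS : 0 < S := by linarith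
  have hdec := heathBrownG_decomp hMT hlam (by linarith) (by linarith)
  have hnear := integral_triangle_mul_expKernel_near hL hlam ha hal
  have hKw := integral_triangle_mul_expKernel_le hL hlam (by linarith : a - lam ≤ 0)
    (by linarith : 0 ≤ a + lam)
  have hKw0 := integral_triangle_mul_expKernel_nonneg (a := a) hL hlam
  obtain ⟨hKa0, hKa⟩ := integral_triangle_mul_abs_near hlam ha hal
  set Kw := ∫ β in (-lam)..lam, (lam - |β|) * (L * Real.exp (-(2 * L) * |a + β|)) with hKw_def
  set Ka := ∫ β in (-lam)..lam, (lam - |β|) * |a + β| with hKa_def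
  have hlam2pos : 0 < lam ^ 2 := by positivity
  have key : |lam ^ 2 * heathBrownG lam a T - (lam - a)| ≤
      C₀ / S * (lam + lam ^ 2) + 5 / (2 * L) + 4 * lam ^ 3 := by
    have e : lam ^ 2 * heathBrownG lam a T - (lam - a) =
        (lam ^ 2 * heathBrownG lam a T - Kw - Ka) + (Kw - (lam - a)) + Ka := by ring
    rw [e]
    have hCS : 0 ≤ C₀ / S := by positivity
    calc |(lam ^ 2 * heathBrownG lam a T - Kw - Ka) + (Kw - (lam - a)) + Ka|
        ≤ |lam ^ 2 * heathBrownG lam a T - Kw - Ka| + |Kw - (lam - a)| + |Ka| :=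
          abs_add_three _ _ _
      _ ≤ C₀ / S * (Kw + lam ^ 2) + 5 / (2 * L) + 4 * lam ^ 3 := by
          refine add_le_add (add_le_add hdec hnear) ?_
          rwa [abs_of_nonneg hKa0]
      _ ≤ C₀ / S * (lam + lam ^ 2) + 5 / (2 * L) + 4 * lam ^ 3 := by
          have : C₀ / S * (Kw + lam ^ 2) ≤ C₀ / S * (lam + lam ^ 2) :=
            mul_le_mul_of_nonneg_left (by linarith) hCS
          linarith
  have e2 : heathBrownG lam a T - (lam - a) / lam ^ 2 =
      (lam ^ 2 * heathBrownG lam a T - (lam - a)) / lam ^ 2 := by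
    field_simp
  rw [e2, abs_div, abs_of_pos hlam2pos, div_le_iff₀ hlam2pos]
  refine key.trans ?_
  have e3 : (2 * C₀ + 4) * (lam + 1 / (lam * S) + 1 / (lam ^ 2 * L)) * lam ^ 2 =
      (2 * C₀ + 4) * (lam ^ 3 + lam / S + 1 / L) := by
    field_simp
  rw [e3]
  have h1 : C₀ / S * (lam + lam ^ 2) ≤ 2 * C₀ * (lam / S) := by
    have e4 : C₀ / S * (lam + lam ^ 2) = C₀ * (lam / S) * (1 + lam) := by
      field_simp
    rw [e4]
    have : 0 ≤ C₀ * (lam / S) := by positivity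
    nlinarith
  have h2 : 0 ≤ C₀ * lam ^ 3 := by positivity
  have h3 : 0 ≤ C₀ * (1 / L) := by positivity
  have h4 : 0 ≤ lam / S := by positivity
  have h5 : 0 < 1 / L := by positivity
  have eR : (2 * C₀ + 4) * (lam ^ 3 + lam / S + 1 / L) =
      2 * (C₀ * lam ^ 3) + 4 * lam ^ 3 + 2 * C₀ * (lam / S) + 4 * (lam / S) +
        2 * (C₀ * (1 / L)) + 4 * (1 / L) := by ring
  have e5 : 5 / (2 * L) = 5 / 2 * (1 / L) := by field_simp
  rw [eR, e5]
  have h6 : 0 ≤ lam ^ 3 := by positivity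
  linarith

/-- Lemma 5 (ii), core estimate at `λ ≤ a ≤ 1 − λ` (BGSTB §5, proof of (lem4-ii)). [cite:
BaluyotGoldstonSuriajayaTurnageButterbaugh2025, §5 proof of Lemma 5 (i)–(ii) (lem4proof)] -/
private theorem heathBrownG_far_core {T L S C₀ lam a : ℝ} (hL1 : 1 ≤ L) (hS1 : 1 ≤ S)
    (hC₀ : 0 ≤ C₀)
    (hMT : ∀ u : ℝ, |u| ≤ 1 →
      |montgomeryFormFactor u T - (L * Real.exp (-(2 * L) * |u|) + |u|)| ≤
        C₀ * (L * Real.exp (-(2 * L) * |u|) + 1) / S)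
    (hlam : 0 < lam) (hla : lam ≤ a) (ha1 : a ≤ 1 - lam) :
    |heathBrownG lam a T - a| ≤ (2 * C₀ + 4) * (1 / S + 1 / (lam ^ 2 * L)) := by
  have hL : 0 < L := by linarith
  have hS : 0 < S := by linarith
  have hdec := heathBrownG_decomp hMT hlam (by linarith) (by linarith)
  have hKw := integral_triangle_mul_expKernel_far hL hlam hla
  have hKw0 := integral_triangle_mul_expKernel_nonneg (a := a) hL hlam
  have hKa := integral_triangle_mul_abs_far hlam hla
  set Kw := ∫ β in (-lam)..lam, (lam - |β|) * (L * Real.exp (-(2 * L) * |a + β|)) with hKw_def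
  rw [hKa] at hdec
  have hlam2pos : 0 < lam ^ 2 := by positivity
  have hCS : 0 ≤ C₀ / S := by positivity
  have key : |lam ^ 2 * heathBrownG lam a T - a * lam ^ 2| ≤
      C₀ / S * (1 / L + lam ^ 2) + 1 / L := by
    have e : lam ^ 2 * heathBrownG lam a T - a * lam ^ 2 =
        (lam ^ 2 * heathBrownG lam a T - Kw - a * lam ^ 2) + Kw := by ring
    rw [e]
    calc |(lam ^ 2 * heathBrownG lam a T - Kw - a * lam ^ 2) + Kw|
        ≤ |lam ^ 2 * heathBrownG lam a T - Kw - a * lam ^ 2| + |Kw| := abs_add_le _ _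
      _ ≤ C₀ / S * (Kw + lam ^ 2) + 1 / L := by
          refine add_le_add hdec ?_
          rwa [abs_of_nonneg hKw0]
      _ ≤ C₀ / S * (1 / L + lam ^ 2) + 1 / L := by
          have : C₀ / S * (Kw + lam ^ 2) ≤ C₀ / S * (1 / L + lam ^ 2) :=
            mul_le_mul_of_nonneg_left (by linarith) hCS
          linarith
  have e2 : heathBrownG lam a T - a = (lam ^ 2 * heathBrownG lam a T - a * lam ^ 2) / lam ^ 2 := by
    field_simp
  rw [e2, abs_div, abs_of_pos hlam2pos, div_le_iff₀ hlam2pos]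
  refine key.trans ?_
  have e3 : (2 * C₀ + 4) * (1 / S + 1 / (lam ^ 2 * L)) * lam ^ 2 =
      (2 * C₀ + 4) * (lam ^ 2 / S + 1 / L) := by
    field_simp
  rw [e3]
  -- `C₀/S · 1/L ≤ C₀ · 1/L` since `S ≥ 1`
  have h1 : C₀ / S * (1 / L) ≤ C₀ * (1 / L) := by
    have : C₀ / S ≤ C₀ := div_le_self hC₀ hS1
    exact mul_le_mul_of_nonneg_right this (by positivity)
  have h2 : 0 ≤ C₀ * (lam ^ 2 / S) := by positivity
  have h3 : 0 ≤ lam ^ 2 / S := by positivity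
  have h4 : 0 < 1 / L := by positivity
  have h5 : 0 ≤ C₀ * (1 / L) := by positivity
  have eL : C₀ / S * (1 / L + lam ^ 2) = C₀ / S * (1 / L) + C₀ * (lam ^ 2 / S) := by
    field_simp
  have eR : (2 * C₀ + 4) * (lam ^ 2 / S + 1 / L) =
      2 * (C₀ * (lam ^ 2 / S)) + 4 * (lam ^ 2 / S) + 2 * (C₀ * (1 / L)) + 4 * (1 / L) := by ring
  rw [eL, eR]
  linarith

end AH

/-- **BGSTB 2025, Lemma 5 (i)–(ii) from Montgomery's theorem (MT)** — the RH half of Lemma 5 as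
typed (`bgstb2025_lemma5_rh`), deduced from (MT) with the Goldston–Montgomery rate on the closed
range `0 ≤ α ≤ 1` and from `F ≥ 0`, both taken as hypotheses in the exact shape of the tree
theorems `Montgomery.montgomery_pair_correlation_sqrtLog_Icc` and
`Montgomery.montgomeryFormFactor_nonneg` (rh-crit/ah SIG-F3 (1), (3)). Printed proof (§5): "For
(i), by the evenness of `G_λ(α)`, we only need to consider the range `0 ≤ α < λ ≤ 1/2`. Then by (MT)
we have from (G_λ) that `G_λ(α) = (1 + O(1/√log T))(λ⁻²∫_{−λ}^{λ}(λ−|β|)T^{−2|α+β|}log T dβ +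
λ⁻²∫_{−λ}^{λ}(λ−|β|)|α+β| dβ) + O(1/√log T)`. Note since `|β| ≤ λ`, we have that `|α+β| ≤ 2λ ≤ 1`
as required in (MT). … The integrals here are all elementary … `= (λ−α)/λ² + O(1/(λ² log T))`.
The second integral … `≪ λ` …". For (ii) "… (MT) applies here because `0 ≤ α+β ≤ 1`. …
`= O(1/(λ² log T))`, and `λ⁻²∫_{−λ}^{λ}(λ−|β|)(α+β) dβ = α`". Our bookkeeping (glosses, not
quotations): with `L = log T ≥ 1` (`T ≥ 3`), `S = √L`, the kernel `L e^{−2L|u|}` has mass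
`1 − (e^{−2L(λ−α)} + e^{−2L(λ+α)})/2` on `[α−λ, α+λ]` (`AH.integral_expKernel`), the boundary terms
cost `≤ 1/(2L)` (`x e^{−2Lx} ≤ 1/(2L)`), the `|α| − |β|` correction `≤ ∫e^{−L|u|} ≤ 2/L`
(`|u| L e^{−2L|u|} ≤ e^{−L|u|}`), and in range (ii) `(λ−|β|) ≤ α+β` gives the first integral
`≤ 1/L` without evaluating it; the (MT)-error is carried additively as
`(C₀/√log T)(∫(λ−|β|)L e^{−2L|α+β|} + λ²)`, which is `≤ 2C₀λ/√log T` in range (i) and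
`≤ C₀(1/log T + λ²)/√log T` in range (ii). Constant: `C = 2|C₀| + 4`.
[cite: BaluyotGoldstonSuriajayaTurnageButterbaugh2025, §5 Lemma 5 (i)–(ii) and proof (lem4proof)] -/
theorem bgstb2025_lemma5_rh_of_MT
    (hMT : RiemannHypothesis → ∃ C : ℝ, ∀ᶠ T : ℝ in atTop, ∀ α : ℝ, α ∈ Set.Icc (0 : ℝ) 1 →
      |montgomeryFormFactor α T - (T ^ (-2 * α) * Real.log T + α)| ≤
        C * (T ^ (-2 * α) * Real.log T + 1) / Real.sqrt (Real.log T))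
    (hF : ∀ (α : ℝ) {T : ℝ}, 1 < T → 0 ≤ montgomeryFormFactor α T) :
    bgstb2025_lemma5_rh := by
  intro hRH
  refine ⟨fun lam α T hlam _ hT ↦ ?_, ?_⟩
  · unfold AH.heathBrownG
    refine mul_nonneg (by positivity) (intervalIntegral.integral_nonneg (by linarith) fun β hβ ↦ ?_)
    have : |β| ≤ lam := abs_le.mpr ⟨by linarith [hβ.1], hβ.2⟩
    exact mul_nonneg (by linarith) (hF _ hT)
  · obtain ⟨C₀, hC₀⟩ := hMT hRH
    refine ⟨2 * |C₀| + 4, ?_⟩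
    filter_upwards [hC₀, eventually_ge_atTop (3 : ℝ)] with T hT hT3
    have hT0 : 0 < T := by linarith
    have hlog1 : 1 ≤ Real.log T := by
      rw [← Real.log_exp 1]
      exact Real.log_le_log (Real.exp_pos 1) (by have := Real.exp_one_lt_d9; linarith)
    have hsq1 : 1 ≤ Real.sqrt (Real.log T) := by
      rw [show (1 : ℝ) = Real.sqrt 1 by simp]; exact Real.sqrt_le_sqrt hlog1
    have hMT' : ∀ u : ℝ, |u| ≤ 1 →
        |montgomeryFormFactor u T -
            (Real.log T * Real.exp (-(2 * Real.log T) * |u|) + |u|)| ≤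
          |C₀| * (Real.log T * Real.exp (-(2 * Real.log T) * |u|) + 1) /
            Real.sqrt (Real.log T) := by
      intro u hu
      have h := hT |u| ⟨abs_nonneg u, hu⟩
      have e : T ^ (-2 * |u|) * Real.log T =
          Real.log T * Real.exp (-(2 * Real.log T) * |u|) := by
        rw [Real.rpow_def_of_pos hT0]
        ring_nf
      have eF : montgomeryFormFactor |u| T = montgomeryFormFactor u T := by
        rcases le_or_gt 0 u with h0 | h0
        · rw [abs_of_nonneg h0]
        · rw [abs_of_neg h0, montgomeryFormFactor_neg]
      rw [e, eF] at h
      refine h.trans (div_le_div_of_nonneg_right ?_ (by positivity))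
      exact mul_le_mul_of_nonneg_right (le_abs_self C₀) (by positivity)
    intro lam hlam hlam2 α
    have heven : AH.heathBrownG lam α T = AH.heathBrownG lam |α| T := by
      rcases le_or_gt 0 α with h0 | h0
      · rw [abs_of_nonneg h0]
      · rw [abs_of_neg h0, AH.heathBrownG_neg]
    refine ⟨fun hα ↦ ?_, fun h1 h2 ↦ ?_⟩
    · rw [heven]
      exact AH.heathBrownG_near_core hlog1 hsq1 (abs_nonneg C₀) hMT' hlam hlam2 (abs_nonneg α)
        hα.le
    · rw [heven]
      exact AH.heathBrownG_far_core hlog1 hsq1 (abs_nonneg C₀) hMT' hlam h1 h2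

/-- **BGSTB 2025, Lemma 5 (i)–(ii) DISCHARGED**: the RH half of Heath-Brown's lemma as typed
(`bgstb2025_lemma5_rh`) is a theorem, from Montgomery's theorem with the Goldston–Montgomery rate
(tree: `Montgomery.montgomery_pair_correlation_sqrtLog_Icc`,
`Montgomery.montgomeryFormFactor_nonneg`,
module `MontgomeryTheoremGoldstonMontgomery`). RH stays the printed antecedent inside the statement.
[cite: BaluyotGoldstonSuriajayaTurnageButterbaugh2025, §5 Lemma 5 (i)–(ii)] -/
theorem bgstb2025_lemma5_rh_holds : bgstb2025_lemma5_rh :=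
  bgstb2025_lemma5_rh_of_MT Montgomery.montgomery_pair_correlation_sqrtLog_Icc
    Montgomery.montgomeryFormFactor_nonneg

/-- **BGSTB 2025, Corollary 5 DISCHARGED**: with the RH half of Lemma 5 now a theorem
(`bgstb2025_lemma5_rh_holds`), Corollary 5 as typed (`bgstb2025_corollary5`; RH the printed
antecedent, the AH-Pairs rate a hypothesis binder) holds outright, by
`bgstb2025_corollary5_of_lemma5_rh`. [cite: BaluyotGoldstonSuriajayaTurnageButterbaugh2025, §5
Corollary 5] -/
theorem bgstb2025_corollary5_holds : bgstb2025_corollary5 :=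
  bgstb2025_corollary5_of_lemma5_rh bgstb2025_lemma5_rh_holds

end Literature.NumberTheory.LFunctions

end
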